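import Literature.Probability.Percolation.ArmSeparationFrame
import Literature.Probability.Percolation.TriLowestCrossingPairs
import HarnessLib

/-!
# The fence of a crossing explored from ABOVE (mirrored fence, below the tip)

Topic `Literature/Probability/Percolation`; family `crit-perc` / near-critical percolation on `𝕋`.
A brick of the near-critical arm-separation theorem for four arms in the ADJACENT colour
arrangement (P. Nolin, EJP 13 (2008), Thm. 11, `j = 4`, `σ = BBWW` [arXiv 0711.4948: Thm. 10];
the last missing input `hsepAdj` of `Werner2009_lemma63_of_altSeparation_of_adjSeparation`).

Two arms of the SAME colour landing on DIFFERENT sides of `∂Λ_{2M}` cannot, in general, be given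
disjoint fenced continuations using only the exploration from below of the two trapezoids (the
minimal terms of the two arms may cross at a single site; see `TrapPairCross*.lean`). The remedy
is a second canonical family of exits: the terms of the exploration FROM ABOVE — the lowest
crossings of the flipped domain `(trapDomain M).flip` (`JDomain.flip`: reference arcs exchanged,
height negated), i.e. the highest crossings. This file builds their fences, mirror images of
those of `ArmSeparationFrame.lean` / `TrapFenceGen.lean`: the frozen set is
`(trapDomain M).flip.lower d z` (the crossing and everything not joined to `trapB ∪ J_{<z}`), the
connection runs in `(trapDomain M).flip.above d z` (sites joined to `trapB ∪ J_{<z}` avoiding `d`)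
and, outside `Λ_{2M}`, strictly BELOW the row of the tip, and the fence is a vertical crossing of
the lower corner box `[z₀+k, z₀+2k] × [z₁-2k, z₁-k]`.

* `sType_of_adj_exterior`, `row_lt_of_sType` — boundary sites next to exterior sites below the
  tip row are bottom-type (for tips off the corners: `-2M < z₁ < 0`);
* `trapFrameZoneBelow` — the mirrored fence zone;
* `trap_invariant_step_below` — closure of the invariant "inside: `flip.above d z`; outside:
  row `< z₁`" along the frame off `d`;
* `trap_exists_fence_below_gen` — the mirrored fence with a stopping set `S ⊇ d`.

Everything here is proved; no named facts are introduced.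

## References

* P. Nolin, Near-critical percolation in two dimensions, *Electron. J. Probab.* 13 (2008), §4.4,
  proof of Lemma 15 (arXiv 0711.4948: Lemma 14) [Nolin2008].
* H. Kesten, *Percolation theory for mathematicians* (1982), §2.3 (highest/lowest crosscuts)
  [KestenPTM1982]; H. Kesten, Scaling relations for 2D-percolation, *CMP* 109 (1987), Lemma 2
  [Kesten1987].

Tree: `FrameData` (`ArmSeparationFrame.lean`), `JDomain.flip*` (`TriLowestCrossingPairs.lean`),
`JDomain.mem_above_of_adj`, `IsCrossing.mem_above_of_mem_Tp/Jabove`,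
`IsCrossing.not_mem_above_of_mem_Bt_union`, `sType_or_nType`, `row_le_of_sType`,
`triNorm_eq_of_adj_exterior`, `trapDomain_cutProp`.
-/

noncomputable section

open Set

namespace Literature.Probability.Percolation

open LatticeModels

/-! ### Bottom-type boundary sites -/

/-- **A boundary site, other than the tip, with an exterior neighbour strictly below the row of
the tip is bottom-type** (for a tip strictly below the top corner, `z₁ < 0`). [cite: KestenPTM1982, §2.3] -/
theorem sType_of_adj_exterior {M : ℕ} {v w z : Site 2} (hv : v ∈ trapD M) (hz : z ∈ trapO M) (hz0 : z 1 < 0)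
    (hne : v ≠ z) (hw : 2 * (M : ℤ) < triNorm w) (hadj : triGraph.Adj v w) (hrow : w 1 < z 1) :
    v ∈ (trapDomain M).Bt ∪ (trapDomain M).Jbelow z := by
  have hn := triNorm_eq_of_adj_exterior hv hw hadj
  rcases sType_or_nType hv hn hz hne with hS | hN
  · exact hS
  · exfalso
    have h1 := triGraph_adj_coord hadj 1
    simp only [Finset.mem_union, trapDomain_Tp, mem_trapDomain_Jabove] at hN
    rcases hN with hU | ⟨-, hlt⟩
    · rw [mem_trapU, mem_trapD] at hU
      omega
    · omega

/-- Bottom-type sites other than the tip lie strictly below the tip (for a tip strictly above the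
bottom corner, `-2M < z₁`). [cite: KestenPTM1982, §2.3] -/
theorem row_lt_of_sType {M : ℕ} {v z : Site 2} (hzB : -(2 * (M : ℤ)) < z 1)
    (hv : v ∈ (trapDomain M).Bt ∪ (trapDomain M).Jbelow z) : v 1 < z 1 := by
  simp only [Finset.mem_union, trapDomain_Bt, mem_trapDomain_Jbelow] at hv
  rcases hv with hB | ⟨-, h⟩
  · rw [mem_trapB] at hB
    omega
  · exact h

/-- Bottom-type of the domain is top-type of the flipped domain. [folklore] -/
theorem mem_flip_Tp_union_iff {M : ℕ} {v z : Site 2} :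
    v ∈ (trapDomain M).flip.Tp ∪ (trapDomain M).flip.Jabove z ↔ v ∈ (trapDomain M).Bt ∪ (trapDomain M).Jbelow z := by
  rw [JDomain.flip_Tp, JDomain.flip_Jabove]

/-- Top-type of the domain is bottom-type of the flipped domain. [folklore] -/
theorem mem_flip_Bt_union_iff {M : ℕ} {v z : Site 2} :
    v ∈ (trapDomain M).flip.Bt ∪ (trapDomain M).flip.Jbelow z ↔ v ∈ (trapDomain M).Tp ∪ (trapDomain M).Jabove z := by
  rw [JDomain.flip_Bt, JDomain.flip_Jbelow]

/-! ### The mirrored zone and the invariant -/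

/-- **The mirrored fence zone**: sites of the trapezoid, or sites outside `Λ_{2M}` strictly below
the row of the tip, within the square of half-width `2k + 1` about `z`. [cite: Nolin2008, §4.4 Lemma 15 (proof) (arXiv 0711.4948: Lemma 14)] -/
def trapFrameZoneBelow (M : ℕ) (z : Site 2) (k : ℕ) : Set (Site 2) :=
  {v | (v ∈ trapD M ∨ (2 * (M : ℤ) < triNorm v ∧ v 1 < z 1)) ∧
    z 0 - (2 * k + 1) ≤ v 0 ∧ v 0 ≤ z 0 + (2 * k + 1) ∧ z 1 - (2 * k + 1) ≤ v 1 ∧ v 1 ≤ z 1 + (2 * k + 1)}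

/-- Membership in the mirrored zone, unfolded. [folklore] -/
theorem mem_trapFrameZoneBelow {M k : ℕ} {z v : Site 2} :
    v ∈ trapFrameZoneBelow M z k ↔ (v ∈ trapD M ∨ (2 * (M : ℤ) < triNorm v ∧ v 1 < z 1)) ∧
      z 0 - (2 * k + 1) ≤ v 0 ∧ v 0 ≤ z 0 + (2 * k + 1) ∧ z 1 - (2 * k + 1) ≤ v 1 ∧ v 1 ≤ z 1 + (2 * k + 1) :=
  Iff.rfl

section Fence

variable {M k : ℕ} {d : Finset (Site 2)} {z : Site 2}

/-- **Closure step of the mirrored invariant** along a `d`-avoiding path inside the union `Y` of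
the top, left and bottom crossings of a frame about the tip `z` of a crossing `d` of the FLIPPED
domain (`2k + 1 ≤ M`, `1 ≤ k`, `-2M < z₁ < 0`): "inside `Λ_{2M}`: `flip.above d z`; outside
`Λ_{2M}`: strictly below the row of the tip" passes from a site of `Y ∖ d` to its neighbours in
`Y ∖ d`. [cite: KestenPTM1982, §2.3 (highest crosscut)] [cite: Kesten1987, Lemma 2] -/
theorem trap_invariant_step_below (hk : 1 ≤ k) (hkM : 2 * (k : ℤ) + 1 ≤ M) (hd : (trapDomain M).flip.IsCrossing d z)
    (hz0 : z 1 < 0) (hzB : -(2 * (M : ℤ)) < z 1)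
    {ω' : SiteConfig (Site 2)} (F : FrameData z k ω') {v w : Site 2} (hv : v ∈ F.Y \ ↑d) (hw : w ∈ F.Y \ ↑d)
    (hadj : triGraph.Adj v w) (hvin : triNorm v ≤ 2 * M → v ∈ (trapDomain M).flip.above d z)
    (hvout : 2 * (M : ℤ) < triNorm v → v 1 < z 1) :
    (triNorm w ≤ 2 * M → w ∈ (trapDomain M).flip.above d z) ∧ (2 * (M : ℤ) < triNorm w → w 1 < z 1) := by
  have hk' : (1 : ℤ) ≤ k := by exact_mod_cast hk
  have hd' : (trapDomain M).IsCrossing d z := (JDomain.flip_isCrossing_iff _).1 hd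
  have hzO := tip_mem_trapO hd'
  have hz' := trapO_coord hzO
  have hcutf : (trapDomain M).flip.CutProp := JDomain.flip_cutProp (trapDomain_cutProp M)
  have hYb : ∀ u ∈ F.Y, z 0 - 2 * k ≤ u 0 ∧ u 0 ≤ z 0 + 2 * k ∧ z 1 - 2 * k ≤ u 1 ∧ u 1 ≤ z 1 + 2 * k :=
    fun u hu => F.boundsK (F.Y_subset_K hu)
  -- sites of `Y` inside `Λ_{2M}` are in the trapezoid
  have hYT : ∀ u ∈ F.Y, triNorm u ≤ 2 * M → u ∈ trapD M := fun u hu hn =>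
    mem_trapD_of_triNorm_le (by have := hYb u hu; omega) hn
  -- exterior sites of `Y` avoid the row of the tip
  have hYrow : ∀ u ∈ F.Y, 2 * (M : ℤ) < triNorm u → u 1 ≠ z 1 := by
    intro u hu hn
    rcases hu with (hu | hu) | hu
    · have := F.boundsN hu; omega
    · have := F.boundsS hu; omega
    · have hb := F.boundsW hu
      rw [triNorm_eq_max] at hn
      simp only [lt_max_iff] at hn
      omega
  have hwd : w ∉ d := fun h => hw.2 (Finset.mem_coe.2 h)
  have hvd : v ∉ d := fun h => hv.2 (Finset.mem_coe.2 h)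
  have hwne : w ≠ z := fun h => hwd (h ▸ hd.tip_mem)
  have hvne : v ≠ z := fun h => hvd (h ▸ hd.tip_mem)
  constructor
  · intro hwn
    have hwT : w ∈ trapD M := hYT w hw.1 hwn
    by_cases hvn : triNorm v ≤ 2 * M
    · exact JDomain.mem_above_of_adj (hvin hvn) hwT hwd hadj
    · rw [not_le] at hvn
      have hS := sType_of_adj_exterior hwT hzO hz0 hwne hvn hadj.symm (hvout hvn)
      rcases Finset.mem_union.1 hS with h | h
      · exact hd.mem_above_of_mem_Tp (by rw [JDomain.flip_Tp]; exact h) hwd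
      · exact hd.mem_above_of_mem_Jabove (by rw [JDomain.flip_Jabove]; exact h)
  · intro hwn
    have h1 := (triGraph_adj_coord hadj 1).1
    have h1' := (triGraph_adj_coord hadj 1).2
    have hne := hYrow w hw.1 hwn
    by_cases hvn : triNorm v ≤ 2 * M
    · -- `v` is a boundary site of the trapezoid; being `flip.above`, it is bottom-type
      have hva := hvin hvn
      have hvT : v ∈ trapD M := hYT v hv.1 hvn
      have hvb : triNorm v = 2 * M := triNorm_eq_of_adj_exterior hvT hwn hadj
      rcases sType_or_nType hvT hvb hzO hvne with hS | hN
      · have := row_lt_of_sType hzB hS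
        omega
      · exact absurd hva (hd.not_mem_above_of_mem_Bt_union hcutf (mem_flip_Bt_union_iff.2 hN))
    · rw [not_le] at hvn
      have := hvout hvn
      omega

/-- **The mirrored fence, stopped at a set `S ⊇ d`.** Let `d` be a crossing of the flipped
trapezoid domain with tip `z` (`-2M < z₁ < 0`); let `ω'` agree with `ω` off `flip.lower d z` and
contain the open frame at scale `k` about `z` (`1 ≤ k`, `2k + 1 ≤ M`); let `S` be a set of sites
of `Λ_{2M}` containing `d`. Then in `ω`: the lower corner box `[z₀+k, z₀+2k] × [z₁-2k, z₁-k]` is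
crossed vertically by open sites through a site `m`, and `m` is joined to a neighbour `p` of a
site `q ∈ S` by an open `S`-avoiding path inside `trapFrameZoneBelow M z k`, whose sites inside
`Λ_{2M}` lie in `flip.above d z` and whose sites outside lie strictly below the row of `z`. [cite: Nolin2008, §4.4 Lemma 15 (proof) (arXiv 0711.4948: Lemma 14)] [cite: Kesten1987, Lemma 2] -/
theorem trap_exists_fence_below_gen (hk : 1 ≤ k) (hkM : 2 * (k : ℤ) + 1 ≤ M) (hd : (trapDomain M).flip.IsCrossing d z)
    (hz0 : z 1 < 0) (hzB : -(2 * (M : ℤ)) < z 1)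
    {ω ω' : SiteConfig (Site 2)}
    (hagree : ∀ v, v ∉ (trapDomain M).flip.lower d z → (v ∈ ω' ↔ v ∈ ω)) (hframe : ω' ∈ triFrameAt z k)
    {S : Set (Site 2)} (hdS : (↑d : Set (Site 2)) ⊆ S) (hSn : ∀ v ∈ S, triNorm v ≤ 2 * M) :
    ∃ m : Site 2, OpenVCrossThrough (triStrip (z 0 + k) (z 1 - 2 * k) k k) (z 1 - 2 * k) (z 1 - k) ω m ∧
      ∃ q ∈ S, ∃ p : Site 2, triGraph.Adj q p ∧
        PathIn triGraph ((trapFrameZoneBelow M z k ∩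
          {v | (triNorm v ≤ 2 * M → v ∈ (trapDomain M).flip.above d z) ∧ (2 * (M : ℤ) < triNorm v → v 1 < z 1)}) ∩
            ω ∩ Sᶜ) p m := by
  have hk' : (1 : ℤ) ≤ k := by exact_mod_cast hk
  have hd' : (trapDomain M).IsCrossing d z := (JDomain.flip_isCrossing_iff _).1 hd
  have hzO := tip_mem_trapO hd'
  have hz' := trapO_coord hzO
  obtain ⟨F⟩ := nonempty_frameData hframe
  -- sites off `flip.lower d z` (in particular sites outside `Λ_{2M}`) carry the same colour in `ω`, `ω'`
  have hlowD : ∀ v ∈ (trapDomain M).flip.lower d z, v ∈ trapD M := fun v hv => JDomain.lower_subset_D hd.subset hv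
  have hext : ∀ v : Site 2, 2 * (M : ℤ) < triNorm v → (v ∈ ω' ↔ v ∈ ω) := by
    intro v hv
    refine hagree v fun h => ?_
    have := (mem_trapD_iff_triNorm.1 (hlowD v h)).2
    omega
  -- the corner box is outside `Λ_{2M}`
  have hEext : ∀ v : Site 2, z 0 + k ≤ v 0 → 2 * (M : ℤ) < triNorm v := by
    intro v hv
    rw [triNorm_eq_max]
    simp only [lt_max_iff]
    omega
  -- the lower part of the right crossing: a vertical crossing `V'` of the lower corner box
  obtain ⟨e₁, e₂, he₁, he₂, hV⟩ := F.pathE.exists_slab_crossing 1 (L := z 1 - 2 * k) (R := z 1 - k)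
    (by omega) (by rw [F.xE1]) (by rw [F.yE1]; omega)
  obtain ⟨SV, hSV, pV, tV⟩ := hV.exists_support
  have hSVb : ∀ v ∈ SV, z 0 + k ≤ v 0 ∧ v 0 ≤ z 0 + 2 * k ∧ z 1 - 2 * k ≤ v 1 ∧ v 1 ≤ z 1 - k := by
    intro v hv
    have h1 := F.boundsE (hSV hv).1
    have h2 := (hSV hv).2
    simp only [Set.mem_setOf_eq] at h2
    omega
  have hSVω : SV ⊆ triStrip (z 0 + k) (z 1 - 2 * k) k k ∩ ω := by
    intro v hv
    have hb := hSVb v hv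
    refine ⟨?_, (hext v (hEext v hb.1)).1 ((F.SE_sub (hSV hv).1).2)⟩
    rw [mem_triStrip]; omega
  -- the bottom crossing meets `V'` at `m`
  obtain ⟨m, hmS, hmV⟩ := PathIn.tri_crossings_meet (L := z 0 - 2 * k) (R := z 0 + 2 * k)
    (B := z 1 - 2 * k) (T := z 1 - k) (fun v hv => by have := F.boundsS hv; omega)
    (fun v hv => by have := hSVb v hv; omega) F.pathS F.xS0 F.yS0 pV he₁ he₂
  refine ⟨m, ⟨e₁, e₂, he₁, he₂, (tV m hmV).mono hSVω, ((tV m hmV).symm.trans pV).mono hSVω⟩, ?_⟩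
  -- `d` (hence `S`) meets `Y`
  have hmY : m ∈ F.Y := Or.inl (Or.inr hmS)
  obtain ⟨f, hfd, hfI⟩ := hd'.exists_start
  obtain ⟨y, hyd, hyK⟩ := F.exists_mem_K hk (s := z) (t := f) (by omega)
    (Or.inl (start_apply_zero_le hd' hkM hfI)) (hd'.conn z hd'.tip_mem f hfd)
  have hyd' : y ∈ d := Finset.mem_coe.1 hyd
  have hyY : y ∈ F.Y := by
    rcases hyK with hy | hy
    · exact hy
    · exfalso
      have h1 := (F.boundsE hy).1
      have h2 := (mem_trapD.1 (hd'.subset hyd')).2.1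
      omega
  -- follow `Y` from `m` to the first site adjacent to `S`
  have hmext : 2 * (M : ℤ) < triNorm m := hEext m (hSVb m hmV).1
  have hmS' : m ∈ Sᶜ := fun h => by have := hSn m h; omega
  obtain ⟨p, q, hpS, hqS, hqY, hpq, hmp⟩ := (F.pathIn_Y hk hmY hyY).exit (R := Sᶜ) hmS' (fun h => h (hdS hyd))
  have hqS' : q ∈ S := not_not.1 hqS
  have hmp' : PathIn triGraph ((F.Y \ ↑d) ∩ Sᶜ) m p :=
    hmp.mono fun v hv => ⟨⟨hv.2, fun hvd => hv.1 (hdS hvd)⟩, hv.1⟩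
  -- the invariant along this path
  set G : Set (Site 2) := {v | (triNorm v ≤ 2 * M → v ∈ (trapDomain M).flip.above d z) ∧
      (2 * (M : ℤ) < triNorm v → v 1 < z 1)} with hG
  have hmG : m ∈ G := ⟨fun h => absurd hmext (not_lt.2 h), fun _ => by have := (hSVb m hmV).2.2.2; omega⟩
  have hpath : PathIn triGraph (((F.Y \ ↑d) ∩ Sᶜ) ∩ G) m p :=
    hmp'.inter_of_invariant hmG fun x w hx hxG hw hxw =>
      trap_invariant_step_below hk hkM hd hz0 hzB F hx.1 hw.1 hxw hxG.1 hxG.2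
  -- sites satisfying the invariant are open sites of the zone
  have hsub : ((F.Y \ ↑d) ∩ Sᶜ) ∩ G ⊆ (trapFrameZoneBelow M z k ∩ G) ∩ ω ∩ Sᶜ := by
    rintro v ⟨⟨⟨hvY, -⟩, hvS⟩, hvin, hvout⟩
    have hb := F.boundsK (F.Y_subset_K hvY)
    have hvω' : v ∈ ω' := F.K_subset (F.Y_subset_K hvY)
    refine ⟨⟨⟨?_, hvin, hvout⟩, ?_⟩, hvS⟩
    · by_cases hvn : triNorm v ≤ 2 * M
      · have hvT : v ∈ trapD M := mem_trapD_of_triNorm_le (by omega) hvn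
        exact ⟨Or.inl hvT, by omega, by omega, by omega, by omega⟩
      · rw [not_le] at hvn
        exact ⟨Or.inr ⟨hvn, hvout hvn⟩, by omega, by omega, by omega, by omega⟩
    · by_cases hvn : triNorm v ≤ 2 * M
      · have hvT : v ∈ trapD M := mem_trapD_of_triNorm_le (by omega) hvn
        -- `v` is `flip.above`, hence off `flip.lower d z`, hence unfrozen
        have hva := hvin hvn
        have hvl : v ∉ (trapDomain M).flip.lower d z := fun h =>
          ((JDomain.mem_lower_iff_not_mem_above (show v ∈ (trapDomain M).flip.D from hvT)).1 h) hva
        exact (hagree v hvl).1 hvω'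
      · rw [not_le] at hvn
        exact (hext v hvn).1 hvω'
  exact ⟨q, hqS', p, hpq.symm, (hpath.mono hsub).symm⟩

end Fence

/-! ### Protection from below -/

/-- **Protection from below, for free** (mirror of `trap_no_closed_escape`). Let `d` be a crossing
of the flipped trapezoid domain with tip `z`, open in `ω`; let `ω'` agree with `ω` off
`flip.lower d z` and contain the open frame at scale `k` about `z`. Then in `ω` no closed `𝕋`-path
of the trapezoid goes from a bottom-type boundary site (`Bt ∪ J_{<z}`) inside the inner box of
the frame to a site outside its outer box: it would meet one of the four crossings at a site open
in `ω'` and closed in `ω`, hence in `flip.lower d z`, hence (being closed) in `flip.below d z` —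
while a path of `T ∖ d` from a bottom-type site stays in `flip.above d z`. [cite: Nolin2008, §4.4 Lemma 15 (proof) (arXiv 0711.4948: Lemma 14)] -/
theorem trap_no_closed_escape_below {M k : ℕ} {d : Finset (Site 2)} {z : Site 2} (hk : 1 ≤ k)
    (hd : (trapDomain M).flip.IsCrossing d z) {ω ω' : SiteConfig (Site 2)}
    (hdω : (↑d : Set (Site 2)) ⊆ ω) (hagree : ∀ v, v ∉ (trapDomain M).flip.lower d z → (v ∈ ω' ↔ v ∈ ω))
    (hframe : ω' ∈ triFrameAt z k) {q t : Site 2} (hq : q ∈ (trapDomain M).Bt ∪ (trapDomain M).Jbelow z)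
    (hqin : z 0 - k ≤ q 0 ∧ q 0 ≤ z 0 + k ∧ z 1 - k ≤ q 1 ∧ q 1 ≤ z 1 + k)
    (ht : t 0 ≤ z 0 - 2 * k ∨ z 0 + 2 * k ≤ t 0 ∨ t 1 ≤ z 1 - 2 * k ∨ z 1 + 2 * k ≤ t 1)
    (hpath : PathIn triGraph ((↑(trapD M) : Set (Site 2)) ∩ ωᶜ) q t) : False := by
  obtain ⟨F⟩ := nonempty_frameData hframe
  obtain ⟨Tq, hTq, hqt, htight⟩ := hpath.exists_support
  obtain ⟨x, hxT, hxK⟩ := F.exists_mem_K hk hqin ht hqt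
  have hxω' : x ∈ ω' := F.K_subset hxK
  have hxω : x ∉ ω := (hTq hxT).2
  -- `x` is frozen, closed, hence flip-below the crossing
  have hxlow : x ∈ (trapDomain M).flip.lower d z := by
    by_contra h
    exact hxω ((hagree x h).1 hxω')
  have hxd : x ∉ d := fun h => hxω (hdω h)
  have hxbelow : x ∈ (trapDomain M).flip.below d z := by
    rcases JDomain.mem_lower.1 hxlow with h | h
    · exact absurd h hxd
    · exact h
  -- but the closed path from the bottom-type site `q` runs in `T ∖ d`, inside `flip.above`
  have hTq' : Tq ⊆ (↑((trapDomain M).flip.D \ d) : Set (Site 2)) := by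
    intro v hv
    rw [Finset.coe_sdiff]
    exact ⟨(hTq hv).1, fun hvd => (hTq hv).2 (hdω hvd)⟩
  have hqd : q ∉ d := fun h => (hTq hqt.left_mem).2 (hdω h)
  have hqabove : q ∈ (trapDomain M).flip.above d z := by
    rcases Finset.mem_union.1 hq with h | h
    · exact hd.mem_above_of_mem_Tp (by rw [JDomain.flip_Tp]; exact h) hqd
    · exact hd.mem_above_of_mem_Jabove (by rw [JDomain.flip_Jabove]; exact h)
  have hxabove : x ∈ (trapDomain M).flip.above d z := JDomain.mem_above_of_pathIn' hqabove ((htight x hxT).mono hTq')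
  exact (JDomain.mem_below.1 hxbelow).2.2 hxabove

end Literature.Probability.Percolation
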